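import Literature.MathematicalPhysics.QuantumFieldTheory.ConformalBootstrap3D.BlockExistence
import Literature.MathematicalPhysics.QuantumFieldTheory.ConformalBootstrap3D.MixedBlockCoefficients
import Mathlib.Analysis.Normed.Group.Tannery
import Mathlib.Analysis.SpecialFunctions.Pow.Continuity
import Mathlib.Tactic
import HarnessLib

/-!
# The 3D block at the unitarity bound and at accidental degeneracies: the limit clause of `IsConformalBlock3D`

Completion of `BlockExistence` (pub-ising3d Limitation (a), "satisfiability of A2") for equal external
dimensions. The typed predicate `IsConformalBlock3D 0 0 Δ₀ ℓ g` has two clauses: at a regular point it is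
the generic predicate (solved by `hrBlock Δ₀ ℓ`, `BlockExistence`); at a NON-regular point — the
unitarity bound `Δ₀ = ℓ+1` (`ℓ ≥ 1`: conserved currents, among them the stress tensor `(3, 2)` present in
every local CFT) and the accidental-degeneracy set — it asks for a family `G Δ'` of generic blocks on
`(Δ₀, Δ₀+1)` converging pointwise to `g` as `Δ' ↓ Δ₀` (Kos–Poland–Simmons-Duffin 2014 §4: blocks at such
points are defined by continuation in `Δ`). This file PROVES that `hrBlock Δ₀ ℓ` satisfies the predicate at
EVERY admissible point:

* `IsAdmissible3D Δ₀ ℓ` — `Δ₀ ≥ unitarityBound3D ℓ`, strictly for `ℓ = 0` (the free-scalar point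
  `(1/2, 0)` is a genuine pole and is excluded, as it must be);
* `IsAdmissible3D.isConformalBlock3D_hrBlock` — `IsConformalBlock3D 0 0 Δ₀ ℓ (hrBlock Δ₀ ℓ)`;
  `exists_isConformalBlock3D_of_isAdmissible`; `isConformalBlock3D_hrBlock_bound` (every conserved
  current `(ℓ+1, ℓ)`, `ℓ ≥ 1`); `isConformalBlock3D_stressTensor` (`(Δ, ℓ) = (3, 2)`).

So, for the `σσσσ`/`εεεε` channels, clause A2 of the typed axioms excludes no operator that 3D
unitarity allows: the exclusion theorems are not vacuous on this account.

Proof. (1) `IsAdmissible3D.pivot_pos`: at an admissible point every descendant-range pivot of level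
`≥ 1` is positive except the single position `(1, ℓ-1)`, whose pivot `2(Δ₀-ℓ-1)` vanishes at the bound;
there the coefficient has the closed form `A_{1,ℓ-1}(Δ) = (Δ-ℓ-1)ℓ/(2(2ℓ+1))` for ALL `Δ`
(`hrCoeff_one_pred_eq`; Hogervorst–Rychkov eq. (2.30)) — the double zero of `γ⁻_{Δ,ℓ} = (Δ-ℓ-1)²ℓ/(2ℓ+1)`
cancels the pole, which is the decoupling of the null descendant of a conserved current for equal
external dimensions. (2) Hence every `A_{n,j}(Δ)`, every level sum and every double-series coefficient
`k^{HR}_{mn}(Δ)` is continuous in `Δ` at an admissible point (`IsAdmissible3D.continuousAt_hrCoeff`,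
induction on the level). (3) The growth mechanism of `BlockExistence` run with the common threshold
`⌈(Δ₀+ℓ+3)²⌉` and a bound `M` for the finitely many lower level sums, uniform on the compact interval
`[Δ₀, Δ₀+1]` by continuity (`IsAdmissible3D.exists_uniform_levelSum_bound`), gives
`Σ_j A_{n,j}(Δ) ≤ M q(n)` for all `n` and all `Δ ∈ (Δ₀, Δ₀+1]`. (4) Tannery's theorem (dominated
convergence for sums, Mathlib `tendsto_tsum_of_dominated_convergence`) with the dominating family
`(M/λ_ℓ) q(m)t^m q(n)t^n`: `K^{HR}_{Δ,ℓ}(z,z̄) → K^{HR}_{Δ₀,ℓ}(z,z̄)` as `Δ ↓ Δ₀`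
(`IsAdmissible3D.tendsto_hrSeries`), and with the continuous prefactor `(z z̄)^{(Δ-ℓ)/2}` the block is
right-continuous in `Δ` (`IsAdmissible3D.tendsto_hrBlock`). (5) Assembly.

What is NOT here: unequal external dimensions (for `Δ₁₂ Δ₃₄ ≠ 0` the block has a genuine pole at
`Δ = ℓ+1`, `MixedBlockCoefficients.hrCoeffAB_one_pred`, and no limit exists — A2 then rightly forces the
absence of spin-`ℓ` currents in `σ × ε`); two-sided continuity in `Δ` (true above the bound, not needed);
values. No new hypothesis-style fact is introduced.

Sources: M. Hogervorst, S. Rychkov, Phys. Rev. D 87 (2013) 106004 [arXiv:1303.1111], §2.2 eqs. (2.27),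
(2.30); F. Kos, D. Poland, D. Simmons-Duffin, JHEP 11 (2014) 109 [arXiv:1406.4858], §4 eqs. (4.2)–(4.3)
(blocks at special `Δ` by continuation; pole structure); the continuity/dominated-convergence argument is
ours (elementary). Mathlib: `tendsto_tsum_of_dominated_convergence` (Tannery), `IsCompact.bddAbove_image`,
`Real.continuous_const_rpow`.
-/

namespace Literature.MathematicalPhysics.QuantumFieldTheory.ConformalBootstrap3D

open Finset Set Filter Topology

/-! ### 1. Admissible points and their pivots -/

/-- An **admissible** internal point for equal external scalars: `Δ₀ ≥ unitarityBound3D ℓ`, and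
strictly above it for `ℓ = 0` (the free-scalar point `(1/2, 0)` is excluded: there the block has a
genuine pole, Hogervorst–Rychkov 2013 §3.1 "B_{2,0} ∼ (Δ-ν)⁻¹"). These are exactly the `(Δ, ℓ)` at which a
unitary CFT may have an operator in the OPE of two identical scalars. [cite: HogervorstRychkov2013, §3.1] -/
def IsAdmissible3D (Δ₀ : ℝ) (ℓ : ℕ) : Prop :=
  unitarityBound3D ℓ ≤ Δ₀ ∧ (ℓ = 0 → unitarityBound3D ℓ < Δ₀)

/-- Points strictly above the bound are admissible. [folklore] -/
theorem isAdmissible3D_of_lt {Δ₀ : ℝ} {ℓ : ℕ} (h : unitarityBound3D ℓ < Δ₀) : IsAdmissible3D Δ₀ ℓ :=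
  ⟨h.le, fun _ => h⟩

/-- The conserved-current points `(ℓ+1, ℓ)`, `ℓ ≥ 1`, are admissible. [folklore] -/
theorem isAdmissible3D_bound {ℓ : ℕ} (hℓ : 1 ≤ ℓ) : IsAdmissible3D ((ℓ : ℝ) + 1) ℓ := by
  have hne : ℓ ≠ 0 := by omega
  refine ⟨?_, fun h => absurd h hne⟩
  unfold unitarityBound3D
  rw [if_neg hne]

/-- An admissible point has `Δ₀ ≥ ℓ + 1` when `ℓ ≥ 1`, and `Δ₀ > 1/2` always. [folklore] -/
theorem IsAdmissible3D.half_lt {Δ₀ : ℝ} {ℓ : ℕ} (h : IsAdmissible3D Δ₀ ℓ) : 1 / 2 < Δ₀ := by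
  obtain ⟨h1, h2⟩ := h
  rcases Nat.eq_zero_or_pos ℓ with hℓ | hℓ
  · have := h2 hℓ
    subst hℓ
    simpa [unitarityBound3D] using this
  · unfold unitarityBound3D at h1
    rw [if_neg (by omega)] at h1
    have : (1 : ℝ) ≤ (ℓ : ℝ) := by exact_mod_cast hℓ
    linarith

/-- For `ℓ ≥ 1` an admissible point has `ℓ + 1 ≤ Δ₀`. [folklore] -/
theorem IsAdmissible3D.le_of_pos {Δ₀ : ℝ} {ℓ : ℕ} (h : IsAdmissible3D Δ₀ ℓ) (hℓ : 1 ≤ ℓ) :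
    (ℓ : ℝ) + 1 ≤ Δ₀ := by
  have h1 := h.1
  unfold unitarityBound3D at h1
  rwa [if_neg (by omega)] at h1

/-- Admissibility is inherited upwards. [folklore] -/
theorem IsAdmissible3D.mono {Δ₀ Δ : ℝ} {ℓ : ℕ} (h : IsAdmissible3D Δ₀ ℓ) (hle : Δ₀ ≤ Δ) :
    IsAdmissible3D Δ ℓ :=
  ⟨h.1.trans hle, fun h0 => (h.2 h0).trans_le hle⟩

/-- **Pivots at an admissible point.** On the descendant range every pivot of level `n ≥ 1` is
positive, with the single exception of the position `(1, ℓ-1)` (whose pivot is `2(Δ₀-ℓ-1)`, vanishing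
exactly at the unitarity bound). [cite: HogervorstRychkov2013, §2.2 eq. (2.27)] -/
theorem IsAdmissible3D.pivot_pos {Δ₀ : ℝ} {ℓ n j : ℕ} (h : IsAdmissible3D Δ₀ ℓ)
    (hn : 1 ≤ n) (hjl : ℓ ≤ j + n) (hju : j ≤ ℓ + n) (hpar : (j + ℓ + n) % 2 = 0)
    (hex : ¬ (n = 1 ∧ j + 1 = ℓ)) : 0 < casimirPivot3D Δ₀ ℓ n j := by
  rcases (h.1).lt_or_eq with hlt | heq
  · exact casimirPivot3D_pos hlt hn hjl hju hpar
  · -- `Δ₀` is the unitarity bound, hence `ℓ ≥ 1` and `Δ₀ = ℓ + 1`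
    have hℓ : 1 ≤ ℓ := by
      by_contra h0
      have h0' : ℓ = 0 := by omega
      exact absurd heq (h.2 h0').ne
    have hΔ : Δ₀ = (ℓ : ℝ) + 1 := by
      rw [← heq]; unfold unitarityBound3D; rw [if_neg (by omega)]
    unfold casimirPivot3D
    rw [hΔ]
    rcases Nat.lt_or_ge n 2 with hn1 | hn2
    · -- level one: `j = ℓ + 1` (the position `j = ℓ - 1` is excluded)
      have hn1' : n = 1 := by omega
      subst hn1'
      have hj : j = ℓ + 1 := by omega
      subst hj
      push_cast
      nlinarith
    · have hn2' : (2 : ℝ) ≤ (n : ℝ) := by exact_mod_cast hn2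
      have hj0 : (0 : ℝ) ≤ (j : ℝ) := Nat.cast_nonneg j
      have hl0 : (0 : ℝ) ≤ (ℓ : ℝ) := Nat.cast_nonneg ℓ
      rcases le_or_gt n ℓ with hnl | hln
      · -- `j ≥ ℓ - n ≥ 0`: `pivot = 2n(n-1) + (j-(ℓ-n))(j+(ℓ-n)+1)`
        have hjl' : (ℓ : ℝ) - (n : ℝ) ≤ (j : ℝ) := by
          have : ((ℓ : ℕ) : ℝ) ≤ (j : ℝ) + (n : ℝ) := by exact_mod_cast hjl
          linarith
        have hln' : (n : ℝ) ≤ (ℓ : ℝ) := by exact_mod_cast hnl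
        nlinarith [mul_nonneg (sub_nonneg.mpr hjl')
          (show (0 : ℝ) ≤ (j : ℝ) + ((ℓ : ℝ) - (n : ℝ)) + 1 by linarith)]
      · -- `ℓ < n`: `pivot ≥ n² - n + ℓ(2n-ℓ-1)`
        have hln' : (ℓ : ℝ) + 1 ≤ (n : ℝ) := by exact_mod_cast hln
        nlinarith [mul_nonneg hl0 (show (0 : ℝ) ≤ 2 * (n : ℝ) - (ℓ : ℝ) - 1 by linarith),
          mul_nonneg hj0 hj0]

/-! ### 2. Continuity of the recursion coefficients in `Δ` at admissible points -/

/-- The exceptional coefficient in closed form, valid for EVERY `Δ` (at `Δ = ℓ+1` both sides vanish,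
the left one by Lean's `0/0 = 0`): `A_{1,ℓ-1}(Δ) = (Δ-ℓ-1) ℓ / (2(2ℓ+1))` (`ℓ ≥ 1`).
(Hogervorst–Rychkov 2013, eq. (2.30), second line, at `ν = 1/2`.) [cite: HogervorstRychkov2013, §2.2 eq. (2.30)] -/
theorem hrCoeff_one_pred_eq (Δ : ℝ) {ℓ : ℕ} (hℓ : 1 ≤ ℓ) :
    hrCoeff Δ ℓ 1 (ℓ - 1) = (Δ - (ℓ : ℝ) - 1) * (ℓ : ℝ) / (2 * (2 * (ℓ : ℝ) + 1)) := by
  have h2 : (2 : ℝ) * (ℓ : ℝ) + 1 ≠ 0 := by positivity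
  by_cases hp : Δ - (ℓ : ℝ) - 1 = 0
  · -- at the bound both sides vanish (`γ⁻_{Δ,ℓ} = 0`; Lean's `0/0 = 0` is not even needed)
    rw [hp, zero_mul, zero_div]
    change hrCoeff Δ ℓ (0 + 1) (ℓ - 1) = 0
    rw [hrCoeff_succ]
    have h1 : ℓ - 1 + 1 = ℓ := Nat.sub_add_cancel hℓ
    have hite : (if ℓ - 1 = 0 then (0 : ℝ)
        else hrGammaPlus (Δ + ((0 : ℕ) : ℝ)) (ℓ - 1 - 1) * hrCoeff Δ ℓ 0 (ℓ - 1 - 1)) = 0 := by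
      split_ifs with h
      · rfl
      · rw [hrCoeff_zero_of_ne Δ (show ℓ - 1 - 1 ≠ ℓ by omega), mul_zero]
    have hγ : hrGammaMinus (Δ + ((0 : ℕ) : ℝ)) ℓ = 0 := by
      unfold hrGammaMinus
      rw [Nat.cast_zero, add_zero, hp]
      ring
    rw [hite, h1, hγ, zero_mul, add_zero, zero_div]
  · have h := hrCoeffAB_one_pred (a := 0) (b := 0) hℓ hp
    rw [hrCoeffAB_zero_zero] at h
    rw [h]
    field_simp
    ring

/-- **Continuity in `Δ` of every recursion coefficient at an admissible point.** Induction on the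
level: off the descendant range the coefficient is identically `0`; on it the pivot is positive at
`Δ₀` (`IsAdmissible3D.pivot_pos`) so the quotient is continuous, except at `(1, ℓ-1)` where the
closed form `hrCoeff_one_pred_eq` is a polynomial. [cite: HogervorstRychkov2013, §2.2 eq. (2.27)] -/
theorem IsAdmissible3D.continuousAt_hrCoeff {Δ₀ : ℝ} {ℓ : ℕ} (h : IsAdmissible3D Δ₀ ℓ) :
    ∀ n j : ℕ, ContinuousAt (fun Δ => hrCoeff Δ ℓ n j) Δ₀ := by
  intro n
  induction n with
  | zero =>
    intro j
    by_cases hj : j = ℓ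
    · subst hj
      simp only [hrCoeff_zero_self]
      exact continuousAt_const
    · simp only [hrCoeff_zero_of_ne _ hj]
      exact continuousAt_const
  | succ n ih =>
    intro j
    by_cases hr : InDescendantRange ℓ (n + 1) j
    · obtain ⟨hjl, hju, hpar⟩ := hr
      by_cases hex : n + 1 = 1 ∧ j + 1 = ℓ
      · -- the exceptional position `(1, ℓ-1)`: closed form
        obtain ⟨hn0, hjℓ⟩ := hex
        have hn : n = 0 := by omega
        subst hn
        have hℓ : 1 ≤ ℓ := by omega
        have hj : j = ℓ - 1 := by omega
        subst hj
        simp only [hrCoeff_one_pred_eq _ hℓ]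
        exact ((continuous_id.sub continuous_const).sub continuous_const).mul continuous_const
          |>.div_const _ |>.continuousAt
      · -- generic position: quotient with non-vanishing pivot
        have hpiv : casimirPivot3D Δ₀ ℓ (n + 1) j ≠ 0 :=
          (h.pivot_pos (by omega) hjl hju hpar hex).ne'
        have hnum : ContinuousAt (fun Δ =>
            (if j = 0 then (0 : ℝ) else hrGammaPlus (Δ + n) (j - 1) * hrCoeff Δ ℓ n (j - 1)) +
              hrGammaMinus (Δ + n) (j + 1) * hrCoeff Δ ℓ n (j + 1)) Δ₀ := by
          refine ContinuousAt.add ?_ ?_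
          · split_ifs
            · exact continuousAt_const
            · refine ContinuousAt.mul ?_ (ih (j - 1))
              unfold hrGammaPlus
              exact ((((continuous_id.add continuous_const).add continuous_const).pow 2).mul
                continuous_const |>.div_const _).continuousAt
          · refine ContinuousAt.mul ?_ (ih (j + 1))
            unfold hrGammaMinus
            exact (((((continuous_id.add continuous_const).sub continuous_const).sub
              continuous_const).pow 2).mul continuous_const |>.div_const _).continuousAt
        have hden : ContinuousAt (fun Δ => casimirPivot3D Δ ℓ (n + 1) j) Δ₀ := by
          unfold casimirPivot3D
          exact (((continuous_const.mul continuous_id).add continuous_const).add continuous_const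
            |>.sub continuous_const).continuousAt
        have key : (fun Δ => hrCoeff Δ ℓ (n + 1) j) = fun Δ =>
            ((if j = 0 then (0 : ℝ) else hrGammaPlus (Δ + n) (j - 1) * hrCoeff Δ ℓ n (j - 1)) +
              hrGammaMinus (Δ + n) (j + 1) * hrCoeff Δ ℓ n (j + 1)) /
              casimirPivot3D Δ ℓ (n + 1) j := by
          funext Δ; rw [hrCoeff_succ]
        rw [key]
        exact hnum.div₀ hden hpiv
    · simp only [hrCoeff_eq_zero_of_not_inDescendantRange _ hr]
      exact continuousAt_const

/-- Continuity of the level sums `Σ_j A_{n,j}(Δ)` at an admissible point. [cite: HogervorstRychkov2013, §2.2 eq. (2.27)] -/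
theorem IsAdmissible3D.continuousAt_hrLevelSum {Δ₀ : ℝ} {ℓ : ℕ} (h : IsAdmissible3D Δ₀ ℓ) (n : ℕ) :
    ContinuousAt (fun Δ => hrLevelSum Δ ℓ n) Δ₀ := by
  unfold hrLevelSum
  exact tendsto_finsetSum _ fun j _ => h.continuousAt_hrCoeff n j

/-- Continuity of every double-power-series coefficient `k^{HR}_{mn}(Δ)` at an admissible point
(a finite combination of the `A_{n,j}(Δ)`). [cite: HogervorstRychkov2013, §2.1 eq. (2.16)] -/
theorem IsAdmissible3D.continuousAt_hrMonomialCoeff {Δ₀ : ℝ} {ℓ : ℕ} (h : IsAdmissible3D Δ₀ ℓ)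
    (p : ℕ × ℕ) : ContinuousAt (fun Δ => hrMonomialCoeff Δ ℓ p) Δ₀ := by
  unfold hrMonomialCoeff hrSlice
  split_ifs
  · exact tendsto_finsetSum _ fun j _ =>
      ((h.continuousAt_hrCoeff _ j).div_const _).mul continuousAt_const
  · exact continuousAt_const

/-! ### 3. Uniform polynomial growth near an admissible point -/

/-- The growth mechanism of `BlockExistence` with an externally supplied threshold and bound: if
`N₁ ≥ (Δ+ℓ+2)²` and `Σ_j A_{k,j}(Δ) ≤ M` for `k ≤ N₁`, then `Σ_j A_{n,j}(Δ) ≤ M q(n)` for EVERY `n`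
(`q(n) = (n+1)(n+2)(n+3)(n+4)`). [cite: HogervorstRychkov2013, §2.2 eq. (2.27)] -/
theorem hrLevelSum_le_of_bound {Δ : ℝ} {ℓ : ℕ} (hΔ : unitarityBound3D ℓ < Δ) {N₁ : ℕ}
    (hN : hrThreshold Δ ℓ ≤ N₁) {M : ℝ} (hM0 : 0 ≤ M)
    (hM : ∀ k : ℕ, k ≤ N₁ → hrLevelSum Δ ℓ k ≤ M) (n : ℕ) :
    hrLevelSum Δ ℓ n ≤ M * quarticWeight n := by
  have hthr : ∀ m : ℕ, N₁ ≤ m → hrThreshold Δ ℓ ≤ m := fun m hm =>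
    hN.trans (by exact_mod_cast hm)
  have hbase : ∀ k : ℕ, k ≤ N₁ → hrLevelSum Δ ℓ k ≤ M * quarticWeight k := fun k hk =>
    calc hrLevelSum Δ ℓ k ≤ M := hM k hk
      _ = M * 1 := (mul_one M).symm
      _ ≤ M * quarticWeight k := mul_le_mul_of_nonneg_left (one_le_quarticWeight k) hM0
  have main : ∀ k : ℕ, hrLevelSum Δ ℓ (N₁ + k) ≤ M * quarticWeight (N₁ + k) := by
    intro k
    induction k with
    | zero => exact hbase _ le_rfl
    | succ k ih =>
      have hq : 0 ≤ 1 + 4 / (((N₁ + k : ℕ) : ℝ) + 1) := by positivity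
      calc hrLevelSum Δ ℓ (N₁ + (k + 1)) = hrLevelSum Δ ℓ (N₁ + k + 1) := by rw [Nat.add_assoc]
        _ ≤ (1 + 4 / (((N₁ + k : ℕ) : ℝ) + 1)) * hrLevelSum Δ ℓ (N₁ + k) :=
            hrLevelSum_succ_le hΔ (hthr _ (Nat.le_add_right _ _))
        _ ≤ (1 + 4 / (((N₁ + k : ℕ) : ℝ) + 1)) * (M * quarticWeight (N₁ + k)) :=
            mul_le_mul_of_nonneg_left ih hq
        _ = M * quarticWeight (N₁ + k + 1) := by
            rw [← quarticWeight_succ (N₁ + k)]; ring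
        _ = M * quarticWeight (N₁ + (k + 1)) := by rw [Nat.add_assoc]
  rcases le_or_gt n N₁ with hn | hn
  · exact hbase n hn
  · obtain ⟨k, rfl⟩ := Nat.exists_eq_add_of_le hn.le
    exact main k

/-- **Uniform growth on `[Δ₀, Δ₀+1]`.** At an admissible point there is ONE constant `M ≥ 0` with
`Σ_j A_{n,j}(Δ) ≤ M q(n)` for all `n` and all `Δ ∈ (Δ₀, Δ₀+1]` (continuity of the finitely many level
sums below the common threshold `⌈(Δ₀+ℓ+3)²⌉` on the compact interval). [cite: HogervorstRychkov2013, §2.2 eq. (2.27)] -/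
theorem IsAdmissible3D.exists_uniform_levelSum_bound {Δ₀ : ℝ} {ℓ : ℕ} (h : IsAdmissible3D Δ₀ ℓ) :
    ∃ M : ℝ, 0 ≤ M ∧ ∀ Δ : ℝ, Δ₀ < Δ → Δ ≤ Δ₀ + 1 → ∀ n : ℕ,
      hrLevelSum Δ ℓ n ≤ M * quarticWeight n := by
  set N₁ := ⌈hrThreshold (Δ₀ + 1) ℓ⌉₊ with hN₁
  -- the sum of the first `N₁ + 1` level sums is continuous on the compact interval
  set F : ℝ → ℝ := fun Δ => ∑ k ∈ range (N₁ + 1), hrLevelSum Δ ℓ k with hF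
  have hcont : ContinuousOn F (Icc Δ₀ (Δ₀ + 1)) := by
    intro Δ hΔ
    have hadm : IsAdmissible3D Δ ℓ := h.mono hΔ.1
    have hca : ContinuousAt F Δ := tendsto_finsetSum _ fun k _ => hadm.continuousAt_hrLevelSum k
    exact hca.continuousWithinAt
  obtain ⟨B, hB⟩ := isCompact_Icc.bddAbove_image hcont
  refine ⟨max B 0, le_max_right _ _, fun Δ hΔ0 hΔ1 n => ?_⟩
  have hΔ : unitarityBound3D ℓ < Δ := lt_of_le_of_lt h.1 hΔ0
  have hFle : F Δ ≤ B := hB ⟨Δ, ⟨hΔ0.le, hΔ1⟩, rfl⟩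
  have hthrmono : hrThreshold Δ ℓ ≤ hrThreshold (Δ₀ + 1) ℓ := by
    unfold hrThreshold
    have h1 : 0 ≤ Δ + ℓ + 2 := by
      have := one_half_lt_of_unitarityBound3D_lt hΔ
      positivity
    nlinarith
  have hN : hrThreshold Δ ℓ ≤ N₁ := hthrmono.trans (Nat.le_ceil _)
  refine hrLevelSum_le_of_bound hΔ hN (le_max_right _ _) (fun k hk => ?_) n
  calc hrLevelSum Δ ℓ k ≤ F Δ :=
        Finset.single_le_sum (f := fun k => hrLevelSum Δ ℓ k) (fun k _ => hrLevelSum_nonneg hΔ k)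
          (mem_range.mpr (Nat.lt_succ_of_le hk))
    _ ≤ B := hFle
    _ ≤ max B 0 := le_max_left _ _

/-! ### 4. Right-continuity of the block in `Δ` at an admissible point -/

/-- **The `z`-series is right-continuous in `Δ`** at every admissible point: for fixed
`z, z̄ ∈ (-1,1)`, `K^{HR}_{Δ,ℓ}(z,z̄) → K^{HR}_{Δ₀,ℓ}(z,z̄)` as `Δ ↓ Δ₀` (Tannery's theorem: termwise
continuity of the coefficients, domination by `M' q(m)t^m q(n)t^n` uniformly on `(Δ₀, Δ₀+1)`).
[cite: HogervorstRychkov2013, §2.1 eq. (2.16)] -/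
theorem IsAdmissible3D.tendsto_hrSeries {Δ₀ : ℝ} {ℓ : ℕ} (h : IsAdmissible3D Δ₀ ℓ) {z zb : ℝ}
    (hz : |z| < 1) (hzb : |zb| < 1) :
    Tendsto (fun Δ => hrSeries Δ ℓ z zb) (𝓝[>] Δ₀) (𝓝 (hrSeries Δ₀ ℓ z zb)) := by
  obtain ⟨M, hM0, hM⟩ := h.exists_uniform_levelSum_bound
  set t := max |z| |zb| with ht
  have ht0 : 0 ≤ t := le_max_of_le_left (abs_nonneg z)
  have ht1 : t < 1 := max_lt hz hzb
  have hlam := legendreLam_pos ℓ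
  -- the dominating family
  set bound : ℕ × ℕ → ℝ := fun p =>
    M / legendreLam ℓ * ((quarticWeight p.1 * t ^ p.1) * (quarticWeight p.2 * t ^ p.2)) with hbound
  have hg := summable_quarticWeight_mul_pow ht0 ht1
  have hsum : Summable bound :=
    (hg.mul_of_nonneg hg (fun m => mul_nonneg (quarticWeight_pos m).le (pow_nonneg ht0 _))
      (fun m => mul_nonneg (quarticWeight_pos m).le (pow_nonneg ht0 _))).mul_left _
  unfold hrSeries
  refine tendsto_tsum_of_dominated_convergence hsum (fun p => ?_) ?_
  · -- termwise continuity
    exact (((h.continuousAt_hrMonomialCoeff p).mul continuousAt_const).mul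
      continuousAt_const).tendsto.mono_left nhdsWithin_le_nhds
  · -- domination on `(Δ₀, Δ₀ + 1)`
    have hmem : Ioo Δ₀ (Δ₀ + 1) ∈ 𝓝[>] Δ₀ := Ioo_mem_nhdsGT (by linarith)
    filter_upwards [hmem] with Δ hΔ p
    have hΔ' : unitarityBound3D ℓ < Δ := lt_of_le_of_lt h.1 hΔ.1
    -- coefficient bound: `k_p ≤ d_{|p|} ≤ (M/λ) q(|p|) ≤ (M/λ) q(p₁) q(p₂)`
    have hk0 := hrMonomialCoeff_nonneg hΔ' p
    have hk : hrMonomialCoeff Δ ℓ p ≤ M / legendreLam ℓ * (quarticWeight p.1 * quarticWeight p.2) := by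
      refine (hrMonomialCoeff_le_diagCoeff hΔ' p).trans ?_
      rcases Nat.lt_or_ge (p.1 + p.2) ℓ with hN | hN
      · have h0 : diagCoeff (hrMonomialCoeff Δ ℓ) (p.1 + p.2) = 0 := by
          unfold diagCoeff
          exact Finset.sum_eq_zero fun q hq =>
            hrMonomialCoeff_eq_zero_of_lt Δ ℓ (by rw [mem_antidiagonal.mp hq]; exact hN)
        rw [h0]
        exact mul_nonneg (div_nonneg hM0 hlam.le)
          (mul_nonneg (quarticWeight_pos _).le (quarticWeight_pos _).le)
      · obtain ⟨n, hn⟩ := Nat.exists_eq_add_of_le hN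
        rw [hn, diagCoeff_hrMonomialCoeff]
        have hle : hrLevelSum Δ ℓ n ≤ M * (quarticWeight p.1 * quarticWeight p.2) :=
          calc hrLevelSum Δ ℓ n ≤ M * quarticWeight n := hM Δ hΔ.1 hΔ.2.le n
            _ ≤ M * quarticWeight (p.1 + p.2) :=
                mul_le_mul_of_nonneg_left (quarticWeight_mono (by omega)) hM0
            _ ≤ M * (quarticWeight p.1 * quarticWeight p.2) :=
                mul_le_mul_of_nonneg_left (quarticWeight_add_le _ _) hM0
        calc hrLevelSum Δ ℓ n / legendreLam ℓ
            ≤ M * (quarticWeight p.1 * quarticWeight p.2) / legendreLam ℓ :=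
              div_le_div_of_nonneg_right hle hlam.le
          _ = M / legendreLam ℓ * (quarticWeight p.1 * quarticWeight p.2) := by ring
    have hzp : |z| ^ p.1 ≤ t ^ p.1 := pow_le_pow_left₀ (abs_nonneg z) (le_max_left _ _) _
    have hzbp : |zb| ^ p.2 ≤ t ^ p.2 := pow_le_pow_left₀ (abs_nonneg zb) (le_max_right _ _) _
    have hq : 0 ≤ M / legendreLam ℓ * (quarticWeight p.1 * quarticWeight p.2) :=
      mul_nonneg (div_nonneg hM0 hlam.le)
        (mul_nonneg (quarticWeight_pos _).le (quarticWeight_pos _).le)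
    rw [Real.norm_eq_abs, abs_mul, abs_mul, abs_of_nonneg hk0, abs_pow, abs_pow]
    calc hrMonomialCoeff Δ ℓ p * |z| ^ p.1 * |zb| ^ p.2
        ≤ (M / legendreLam ℓ * (quarticWeight p.1 * quarticWeight p.2)) * t ^ p.1 * t ^ p.2 :=
          mul_le_mul (mul_le_mul hk hzp (pow_nonneg (abs_nonneg _) _) hq) hzbp
            (pow_nonneg (abs_nonneg _) _) (mul_nonneg hq (pow_nonneg ht0 _))
      _ = bound p := by rw [hbound]; ring

/-- **The block is right-continuous in `Δ`** at every admissible point, pointwise on the open square.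
[cite: HogervorstRychkov2013, §2.1 eq. (2.16)] -/
theorem IsAdmissible3D.tendsto_hrBlock {Δ₀ : ℝ} {ℓ : ℕ} (h : IsAdmissible3D Δ₀ ℓ) {z zb : ℝ}
    (hz : z ∈ Ioo (0 : ℝ) 1) (hzb : zb ∈ Ioo (0 : ℝ) 1) :
    Tendsto (fun Δ => hrBlock Δ ℓ z zb) (𝓝[>] Δ₀) (𝓝 (hrBlock Δ₀ ℓ z zb)) := by
  unfold hrBlock
  have hzabs : |z| < 1 := by rw [abs_of_pos hz.1]; exact hz.2
  have hzbabs : |zb| < 1 := by rw [abs_of_pos hzb.1]; exact hzb.2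
  have hpow : Tendsto (fun Δ : ℝ => (z * zb) ^ ((Δ - (ℓ : ℝ)) / 2)) (𝓝[>] Δ₀)
      (𝓝 ((z * zb) ^ ((Δ₀ - (ℓ : ℝ)) / 2))) := by
    have hc : Continuous fun Δ : ℝ => (z * zb) ^ ((Δ - (ℓ : ℝ)) / 2) :=
      (Real.continuous_const_rpow (mul_pos hz.1 hzb.1).ne').comp
        ((continuous_id.sub continuous_const).div_const _)
    exact hc.continuousAt.tendsto.mono_left nhdsWithin_le_nhds
  exact hpow.mul (h.tendsto_hrSeries hzabs hzbabs)

/-! ### 5. The genuine predicate at every admissible point -/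

/-- **`hrBlock` satisfies `IsConformalBlock3D` at EVERY admissible point** (equal external dimensions):
at regular points by `BlockExistence`, and at the unitarity bound (`ℓ ≥ 1`) and on the
accidental-degeneracy set by the limit clause, the witnessing family being `Δ' ↦ hrBlock Δ' ℓ` on
`(Δ₀, Δ₀+1)`. [cite: KosPolandSimmonsduffin2014, §4 eqs. (4.2)–(4.3)] -/
theorem IsAdmissible3D.isConformalBlock3D_hrBlock {Δ₀ : ℝ} {ℓ : ℕ} (h : IsAdmissible3D Δ₀ ℓ) :
    IsConformalBlock3D 0 0 Δ₀ ℓ (hrBlock Δ₀ ℓ) := by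
  by_cases hreg : IsRegularPoint3D Δ₀ ℓ
  · have hlt : unitarityBound3D ℓ < Δ₀ := lt_of_le_of_ne h.1 (Ne.symm hreg.1)
    exact Or.inl ⟨hreg, isConformalBlock3DAbove_hrBlock hlt⟩
  · refine Or.inr ⟨hreg, fun Δ' => hrBlock Δ' ℓ, fun Δ' hΔ' => ?_, fun z zb hz hzb => ?_⟩
    · exact isConformalBlock3DAbove_hrBlock (lt_of_le_of_lt h.1 hΔ'.1)
    · exact h.tendsto_hrBlock hz hzb

/-- **Satisfiability of A2 at every admissible point** (equal external dimensions): for every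
`(Δ, ℓ)` allowed by 3D unitarity in the OPE of two identical scalars — `Δ ≥ ℓ + 1` for `ℓ ≥ 1`,
`Δ > 1/2` for `ℓ = 0` — the typed block predicate has a solution.
[cite: KosPolandSimmonsduffin2014, §4 eqs. (4.2)–(4.3)] -/
theorem exists_isConformalBlock3D_of_isAdmissible {Δ₀ : ℝ} {ℓ : ℕ} (h : IsAdmissible3D Δ₀ ℓ) :
    ∃ g : ℝ → ℝ → ℝ, IsConformalBlock3D 0 0 Δ₀ ℓ g :=
  ⟨hrBlock Δ₀ ℓ, h.isConformalBlock3D_hrBlock⟩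

/-- In particular every conserved-current block exists as a typed block: for `ℓ ≥ 1`,
`IsConformalBlock3D 0 0 (ℓ+1) ℓ (hrBlock (ℓ+1) ℓ)`. [cite: KosPolandSimmonsduffin2014, §4 eqs. (4.2)–(4.3)] -/
theorem isConformalBlock3D_hrBlock_bound {ℓ : ℕ} (hℓ : 1 ≤ ℓ) :
    IsConformalBlock3D 0 0 ((ℓ : ℝ) + 1) ℓ (hrBlock ((ℓ : ℝ) + 1) ℓ) :=
  (isAdmissible3D_bound hℓ).isConformalBlock3D_hrBlock

/-- **The stress-tensor block exists**: `IsConformalBlock3D 0 0 3 2 (hrBlock 3 2)` — the operator that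
every local CFT contains sits exactly at the spin-`2` unitarity bound, where the typed predicate is the
limit clause. [cite: KosPolandSimmonsduffin2014, §4 eqs. (4.2)–(4.3)] -/
theorem isConformalBlock3D_stressTensor : IsConformalBlock3D 0 0 3 2 (hrBlock 3 2) := by
  have h := isConformalBlock3D_hrBlock_bound (ℓ := 2) (by norm_num)
  norm_num at h
  exact h

end Literature.MathematicalPhysics.QuantumFieldTheory.ConformalBootstrap3D
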